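import Summits.QuantumFields.YangMills.Theorems.ColdStartUniversalityLatticeLangevinDossSussmannSmoothingKernel
import Summits.QuantumFields.YangMills.Theorems.ColdStartUniversalityLatticeLangevinGeneratorInvariance
import Summits.QuantumFields.YangMills.Theorems.ColdStartUniversalityLatticeLangevinFellerJoint
import Summits.QuantumFields.YangMills.Theorems.ColdStartUniversalityLatticeLangevinCocycleMain
import Summits.QuantumFields.YangMills.Theorems.ColdStartUniversalityLatticeLangevinInvariantOfKernel
import HarnessLib

/-!
# Route `ColdStartUniversality` (fixed-cut-off SZZ dynamics; Doss–Sussmann smoothing programme, file 16):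
# THE BACKWARD KOLMOGOROV EQUATION AND `𝓛 κ_t = κ_t 𝓛` ON THE DYNKIN CLASS

Helper file (seat `ym-line-csu-p1`, g24).  First consequence of `P_t(C³_c) ⊂ C³_c` (files 13–15) for the fixed-cut-off
semigroup package: for ANY Markov kernel family `κ` realising the transition laws of the SU(2) lattice Langevin (SZZ)
dynamics at coupling `β'`, every `C³` compactly supported `f` of the real link coordinates (`F = f ∘ coords`, the class of
`dynkin_expectation_szz`) and every lattice time `t`:
★★★ `transitionKernel_backwardKolmogorov` — there is `g ∈ C³_c` with `κ_t F = g ∘ coords`, the GENERATOR COMMUTES WITH THE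
SEMIGROUP, `𝓛(g ∘ coords)(x) = κ_t(𝓛F)(x)`, and `τ ↦ κ_τ F(x)` has right derivative `𝓛(κ_t F)(x)` at `τ = t` (classical
backward Kolmogorov equation on the Dynkin class; `𝓛` = the coordinate generator `gen` of `dynkin_forward`).
Proof: Dynkin in kernel form (`transitionKernel_dynkin`) for `f` gives the forward derivative `κ_t(𝓛F)(x)`; Chapman–Kolmogorov
(`chapmanKolmogorov_szz`) `κ_{τ} F(x) = κ_{τ-t}(κ_t F)(x)` and Dynkin for `g` give the right derivative `𝓛(κ_t F)(x)`
(`κ_0 = id`, joint continuity of the kernel action); uniqueness of one-sided derivatives identifies them.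
THEOREMS ONLY, no sorry.  HONEST FRAMING: fixed-cut-off semigroup calculus; nothing K-uniform; no crux, rung or summit
statement is proved; the Yang–Mills mass gap is NOT proved.
-/

set_option autoImplicit false

noncomputable section

namespace Summit.QuantumFields.YangMills.Theorems.ColdStartUniversality

open MeasureTheory ProbabilityTheory Finset Filter Set
open scoped BigOperators NNReal ENNReal Topology
open Literature.Probability.Process Literature.MathematicalPhysics.QuantumFieldTheory
open Literature.MathematicalPhysics.QuantumLattice (fundamentalRep fundamentalLatticeRep continuous_fundamentalRep)

variable {L : ℕ} [NeZero L]

/-- ★★★ **Backward Kolmogorov equation and generator–semigroup commutation on the Dynkin class.**  For any realising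
Markov kernel family `κ` of the SU(2) SZZ dynamics at coupling `β'`, `f ∈ C³_c` of the real link coordinates and `t ≥ 0`:
there is `g ∈ C³_c` with `κ_t(f∘coords) = g∘coords` on `SU(2)^E`; `𝓛(g∘coords)(x) = κ_t(𝓛(f∘coords))(x)` for all `x`;
and `τ ↦ κ_τ(f∘coords)(x)` has right derivative `𝓛(g∘coords)(x)` at `τ = t`. [folklore] -/
theorem transitionKernel_backwardKolmogorov (β' : ℝ)
    (κ : ℝ≥0 → Kernel (GaugeConfig 3 L (Matrix.specialUnitaryGroup (Fin 2) ℂ))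
      (GaugeConfig 3 L (Matrix.specialUnitaryGroup (Fin 2) ℂ))) [∀ t, IsMarkovKernel (κ t)]
    (hreal : ∀ (t : ℝ≥0) (x : GaugeConfig 3 L (Matrix.specialUnitaryGroup (Fin 2) ℂ))
        (Ω : Type) [MeasurableSpace Ω] (P : Measure Ω) [IsProbabilityMeasure P]
        (W : ℝ≥0 → Ω → (Edge 3 L × NoiseIdx 2 → ℝ)) (hW : IsFlatBrownian W P)
        (U : ℝ≥0 → Ω → GaugeConfig 3 L (Matrix.specialUnitaryGroup (Fin 2) ℂ)),
        (∀ ω, U 0 ω = x) →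
        (latticeLangevinDynamics (fundamentalLatticeRep 2) β').IsSolution (fundamentalRep (Fin 2))
          hW.natFiltration P W U →
        κ t x = P.map (U t))
    {f : (Edge 3 L × Fin 2 × Fin 2 × Bool → ℝ) → ℝ} (hf : ContDiff ℝ 3 f) (hfc : HasCompactSupport f) (t : ℝ≥0) :
    let coords : GaugeConfig 3 L (Matrix.specialUnitaryGroup (Fin 2) ℂ) → (Edge 3 L × Fin 2 × Fin 2 × Bool → ℝ) :=
      fun V q => (fun z : ℂ => if q.2.2.2 then z.im else z.re)
        ((fundamentalRep (Fin 2) (V q.1) : Matrix (Fin 2) (Fin 2) ℂ) q.2.1 q.2.2.1)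
    let gen : ((Edge 3 L × Fin 2 × Fin 2 × Bool → ℝ) → ℝ) → GaugeConfig 3 L (Matrix.specialUnitaryGroup (Fin 2) ℂ) → ℝ :=
      fun φ V =>
      (∑ i : Edge 3 L × Fin 2 × Fin 2 × Bool, fderiv ℝ φ (coords V) (Pi.single i 1) *
          (fun z : ℂ => if i.2.2.2 then z.im else z.re)
            ((latticeLangevinDynamics (fundamentalLatticeRep 2) β').drift
              (matrixConfig (fundamentalRep (Fin 2)) V) i.1 i.2.1 i.2.2.1) +
      1 / 2 * ∑ i : Edge 3 L × Fin 2 × Fin 2 × Bool, ∑ j : Edge 3 L × Fin 2 × Fin 2 × Bool,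
        fderiv ℝ (fun z => fderiv ℝ φ z (Pi.single i 1)) (coords V) (Pi.single j 1) *
          ∑ n : Edge 3 L × NoiseIdx 2,
            (if n.1 = i.1 then (fun z : ℂ => if i.2.2.2 then z.im else z.re)
              ((latticeLangevinDynamics (fundamentalLatticeRep 2) β').noise
                (matrixConfig (fundamentalRep (Fin 2)) V) i.1 n.2 i.2.1 i.2.2.1) else 0) *
            (if n.1 = j.1 then (fun z : ℂ => if j.2.2.2 then z.im else z.re)
              ((latticeLangevinDynamics (fundamentalLatticeRep 2) β').noise
                (matrixConfig (fundamentalRep (Fin 2)) V) j.1 n.2 j.2.1 j.2.2.1) else 0))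
    ∃ g : (Edge 3 L × Fin 2 × Fin 2 × Bool → ℝ) → ℝ, ContDiff ℝ 3 g ∧ HasCompactSupport g ∧
      (∀ x, ∫ y, f (coords y) ∂(κ t x) = g (coords x)) ∧
      (∀ x, gen g x = ∫ y, gen f y ∂(κ t x)) ∧
      (∀ x, HasDerivWithinAt (fun τ : ℝ => ∫ y, f (coords y) ∂(κ τ.toNNReal x)) (gen g x) (Ici (t : ℝ)) t) := by
  intro coords gen
  classical
  haveI := secondCountableTopology_su2
  haveI := borelSpace_config L
  have hco : Continuous coords := continuous_coords (L := L)
  -- the smooth compactly supported `g` with `κ_t F = g ∘ coords`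
  obtain ⟨g, hg, hgc, hgF⟩ := transitionKernel_preserves_dynkinClass L β' κ hreal t hf
  have hFc : Continuous fun V => f (coords V) := hf.continuous.comp hco
  have hGc : Continuous fun V => g (coords V) := hg.continuous.comp hco
  have hgenf : Continuous (gen f) := continuous_generator (L := L) β' (hf.of_le (by norm_num))
  have hgeng : Continuous (gen g) := continuous_generator (L := L) β' (hg.of_le (by norm_num))
  have hInt : ∀ (ν : Measure (GaugeConfig 3 L (Matrix.specialUnitaryGroup (Fin 2) ℂ))) [IsProbabilityMeasure ν]
      {G : GaugeConfig 3 L (Matrix.specialUnitaryGroup (Fin 2) ℂ) → ℝ}, Continuous G → Integrable G ν :=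
    fun ν _ G hG => integrable_of_continuous_of_compactSpace hG ν
  -- joint continuity of the kernel action ⇒ continuity in time at a fixed start
  have hact : ∀ {G : GaugeConfig 3 L (Matrix.specialUnitaryGroup (Fin 2) ℂ) → ℝ}, Continuous G →
      ∀ x, Continuous fun r : ℝ => ∫ y, G y ∂(κ r.toNNReal x) := by
    intro G hG x
    exact (continuous_transitionKernel_action (L := L) β' κ hreal hG).comp
      (continuous_real_toNNReal.prodMk continuous_const)
  have hκ0 : κ 0 = Kernel.id := transitionKernel_zero_eq_id (L := L) (β' := β') κ hreal
  refine ⟨g, hg, hgc, hgF, ?_⟩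
  -- for each start: the two one-sided derivatives
  have key : ∀ x, HasDerivWithinAt (fun τ : ℝ => ∫ y, f (coords y) ∂(κ τ.toNNReal x)) (∫ y, gen f y ∂(κ t x))
      (Ici (t : ℝ)) t ∧
      HasDerivWithinAt (fun τ : ℝ => ∫ y, f (coords y) ∂(κ τ.toNNReal x)) (gen g x) (Ici (t : ℝ)) t := by
    intro x
    have ht0 : (0 : ℝ) ≤ t := t.coe_nonneg
    -- Dynkin for `f`: forward derivative
    have hDf := fun {τ : ℝ} (hτ : (0 : ℝ) ≤ τ) => transitionKernel_dynkin (L := L) β' κ hreal hf hfc x hτ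
    have hfwd : HasDerivWithinAt (fun τ : ℝ => ∫ y, f (coords y) ∂(κ τ.toNNReal x)) (∫ y, gen f y ∂(κ t x))
        (Ici (t : ℝ)) t := by
      have ha : Continuous fun r : ℝ => ∫ y, gen f y ∂(κ r.toNNReal x) := hact hgenf x
      have hder : HasDerivAt (fun τ : ℝ => f (coords x) + ∫ r in (0 : ℝ)..τ, ∫ y, gen f y ∂(κ r.toNNReal x))
          (∫ y, gen f y ∂(κ (t : ℝ).toNNReal x)) t :=
        ((intervalIntegral.integral_hasDerivAt_right (ha.intervalIntegrable _ _)
          (ha.stronglyMeasurableAtFilter _ _) ha.continuousAt)).const_add _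
      rw [Real.toNNReal_coe] at hder
      refine hder.hasDerivWithinAt.congr_of_eventuallyEq ?_ ?_
      · filter_upwards [self_mem_nhdsWithin] with τ hτ
        exact (hDf (ht0.trans hτ))
      · exact hDf ht0
    -- Chapman–Kolmogorov and Dynkin for `g`: backward derivative
    have hDg := fun {τ : ℝ} (hτ : (0 : ℝ) ≤ τ) => transitionKernel_dynkin (L := L) β' κ hreal hg hgc x hτ
    have hbwd : HasDerivWithinAt (fun τ : ℝ => ∫ y, f (coords y) ∂(κ τ.toNNReal x)) (gen g x) (Ici (t : ℝ)) t := by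
      have hb : Continuous fun r : ℝ => ∫ y, gen g y ∂(κ (r - t).toNNReal x) :=
        (hact hgeng x).comp (continuous_id.sub continuous_const)
      have hder : HasDerivAt (fun τ : ℝ => g (coords x) + ∫ r in (t : ℝ)..τ, ∫ y, gen g y ∂(κ (r - t).toNNReal x))
          (∫ y, gen g y ∂(κ ((t : ℝ) - t).toNNReal x)) t :=
        ((intervalIntegral.integral_hasDerivAt_right (hb.intervalIntegrable _ _)
          (hb.stronglyMeasurableAtFilter _ _) hb.continuousAt)).const_add _
      have h00 : ∫ y, gen g y ∂(κ ((t : ℝ) - t).toNNReal x) = gen g x := by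
        rw [sub_self, Real.toNNReal_zero, hκ0, Kernel.id_apply, integral_dirac' _ _ hgeng.measurable.stronglyMeasurable]
      rw [h00] at hder
      refine hder.hasDerivWithinAt.congr_of_eventuallyEq ?_ ?_
      · filter_upwards [self_mem_nhdsWithin] with τ hτ
        have hτt : (0 : ℝ) ≤ τ - t := sub_nonneg.2 hτ
        -- `κ_τ F(x) = κ_{τ-t} (κ_t F)(x) = κ_{τ-t} G (x)` and Dynkin for `g`
        have hsplit : τ.toNNReal = (τ - t).toNNReal + t := by
          apply NNReal.eq
          rw [NNReal.coe_add, Real.coe_toNNReal _ (ht0.trans hτ), Real.coe_toNNReal _ hτt]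
          ring
        have hCK : ∫ y, f (coords y) ∂(κ τ.toNNReal x) = ∫ y, g (coords y) ∂(κ (τ - t).toNNReal x) := by
          rw [hsplit, chapmanKolmogorov_szz β' κ hreal (τ - t).toNNReal t]
          haveI : IsProbabilityMeasure ((κ t ∘ₖ κ (τ - t).toNNReal) x) := by
            rw [← chapmanKolmogorov_szz β' κ hreal (τ - t).toNNReal t]; infer_instance
          rw [Kernel.integral_comp (hInt _ hFc)]
          exact integral_congr_ae (ae_of_all _ fun y => hgF y)
        rw [hCK, hDg hτt, intervalIntegral.integral_comp_sub_right (fun r => ∫ y, gen g y ∂(κ r.toNNReal x)) (t : ℝ),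
          sub_self]
      · show ∫ y, f (coords y) ∂(κ (t : ℝ).toNNReal x) = g (coords x) + ∫ r in (t : ℝ)..t, _
        rw [intervalIntegral.integral_same, add_zero, Real.toNNReal_coe, hgF x]
    exact ⟨hfwd, hbwd⟩
  refine ⟨fun x => ?_, fun x => (key x).2⟩
  have hU : UniqueDiffWithinAt ℝ (Ici (t : ℝ)) t := uniqueDiffOn_Ici (t : ℝ) t self_mem_Ici
  rw [← (key x).2.derivWithin hU, (key x).1.derivWithin hU]

/-- **Two-sided time derivative for `t > 0`.**  In the setting of `transitionKernel_backwardKolmogorov`, for `t > 0` the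
function `τ ↦ κ_τ(f∘coords)(x)` is differentiable at `t` with derivative `κ_t(𝓛(f∘coords))(x)` (forward form; by the
commutation identity of `transitionKernel_backwardKolmogorov` this is also `𝓛(κ_t(f∘coords))(x)`). [folklore] -/
theorem transitionKernel_hasDerivAt (β' : ℝ)
    (κ : ℝ≥0 → Kernel (GaugeConfig 3 L (Matrix.specialUnitaryGroup (Fin 2) ℂ))
      (GaugeConfig 3 L (Matrix.specialUnitaryGroup (Fin 2) ℂ))) [∀ t, IsMarkovKernel (κ t)]
    (hreal : ∀ (t : ℝ≥0) (x : GaugeConfig 3 L (Matrix.specialUnitaryGroup (Fin 2) ℂ))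
        (Ω : Type) [MeasurableSpace Ω] (P : Measure Ω) [IsProbabilityMeasure P]
        (W : ℝ≥0 → Ω → (Edge 3 L × NoiseIdx 2 → ℝ)) (hW : IsFlatBrownian W P)
        (U : ℝ≥0 → Ω → GaugeConfig 3 L (Matrix.specialUnitaryGroup (Fin 2) ℂ)),
        (∀ ω, U 0 ω = x) →
        (latticeLangevinDynamics (fundamentalLatticeRep 2) β').IsSolution (fundamentalRep (Fin 2))
          hW.natFiltration P W U →
        κ t x = P.map (U t))
    {f : (Edge 3 L × Fin 2 × Fin 2 × Bool → ℝ) → ℝ} (hf : ContDiff ℝ 3 f) (hfc : HasCompactSupport f)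
    (x : GaugeConfig 3 L (Matrix.specialUnitaryGroup (Fin 2) ℂ)) {t : ℝ} (ht : 0 < t) :
    let coords : GaugeConfig 3 L (Matrix.specialUnitaryGroup (Fin 2) ℂ) → (Edge 3 L × Fin 2 × Fin 2 × Bool → ℝ) :=
      fun V q => (fun z : ℂ => if q.2.2.2 then z.im else z.re)
        ((fundamentalRep (Fin 2) (V q.1) : Matrix (Fin 2) (Fin 2) ℂ) q.2.1 q.2.2.1)
    let gen : GaugeConfig 3 L (Matrix.specialUnitaryGroup (Fin 2) ℂ) → ℝ := fun V =>
      (∑ i : Edge 3 L × Fin 2 × Fin 2 × Bool, fderiv ℝ f (coords V) (Pi.single i 1) *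
          (fun z : ℂ => if i.2.2.2 then z.im else z.re)
            ((latticeLangevinDynamics (fundamentalLatticeRep 2) β').drift
              (matrixConfig (fundamentalRep (Fin 2)) V) i.1 i.2.1 i.2.2.1) +
      1 / 2 * ∑ i : Edge 3 L × Fin 2 × Fin 2 × Bool, ∑ j : Edge 3 L × Fin 2 × Fin 2 × Bool,
        fderiv ℝ (fun z => fderiv ℝ f z (Pi.single i 1)) (coords V) (Pi.single j 1) *
          ∑ n : Edge 3 L × NoiseIdx 2,
            (if n.1 = i.1 then (fun z : ℂ => if i.2.2.2 then z.im else z.re)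
              ((latticeLangevinDynamics (fundamentalLatticeRep 2) β').noise
                (matrixConfig (fundamentalRep (Fin 2)) V) i.1 n.2 i.2.1 i.2.2.1) else 0) *
            (if n.1 = j.1 then (fun z : ℂ => if j.2.2.2 then z.im else z.re)
              ((latticeLangevinDynamics (fundamentalLatticeRep 2) β').noise
                (matrixConfig (fundamentalRep (Fin 2)) V) j.1 n.2 j.2.1 j.2.2.1) else 0))
    HasDerivAt (fun τ : ℝ => ∫ y, f (coords y) ∂(κ τ.toNNReal x)) (∫ y, gen y ∂(κ t.toNNReal x)) t := by
  intro coords gen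
  classical
  have hgen : Continuous gen := continuous_generator (L := L) β' (hf.of_le (by norm_num))
  have ha : Continuous fun r : ℝ => ∫ y, gen y ∂(κ r.toNNReal x) :=
    (continuous_transitionKernel_action (L := L) β' κ hreal hgen).comp
      (continuous_real_toNNReal.prodMk continuous_const)
  have hDf := fun {τ : ℝ} (hτ : (0 : ℝ) ≤ τ) => transitionKernel_dynkin (L := L) β' κ hreal hf hfc x hτ
  have hder : HasDerivAt (fun τ : ℝ => f (coords x) + ∫ r in (0 : ℝ)..τ, ∫ y, gen y ∂(κ r.toNNReal x))
      (∫ y, gen y ∂(κ t.toNNReal x)) t :=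
    ((intervalIntegral.integral_hasDerivAt_right (ha.intervalIntegrable _ _)
      (ha.stronglyMeasurableAtFilter _ _) ha.continuousAt)).const_add _
  refine hder.congr_of_eventuallyEq ?_
  filter_upwards [Ioi_mem_nhds ht] with τ hτ
  exact hDf (le_of_lt hτ)

end Summit.QuantumFields.YangMills.Theorems.ColdStartUniversality

end
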